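import Summits.BirchSwinnertonDyer.BirchSwinnertonDyer.Theorems.EisensteinPrimesMazurMCOnCellBTwistbackSubrowPartnerGivenBernoulli
import Summits.BirchSwinnertonDyer.BirchSwinnertonDyer.Theorems.EisensteinPrimesMazurMCOnCellBTwistbackSubrowPartnerGivenPAdicGZ
import HarnessLib

/-!
# Crux 3 `MazurMCOnCellB` (stmt-BirchSwinnertonDyer-19033), line `twistback` v6 — stub 6′ (∃-PARTNER) AT a non-split X2b
# pair `(W, p)`, `K` GIVEN, at EVERY odd `p`, ARBITRARY line characters, PUBLISHED facts only: LEAD g12's Bernoulli-unit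
# doors (p659820) `_of_padicGZ` (Disegni 2020 Thm. 2.4 in place of Keller–Yin Thm. E)

Width seat bsd-line-x2-p1-w3 (g11), 2026-08-28 — LEAD g13's WORKER FIT (F1). Sequel of `…TwistbackSubrowPartnerGivenPAdicGZ`
(this seat, p661057) over LEAD g12's `…TwistbackSubrowPartnerGivenBernoulli` (p659820). HONEST FRAMING (cell `bsd-eis`,
run/shared/lean/pub/bsd-eis/): conditional theorems only; named facts BY NAME — the route's `PublishedInputs`
(stmt-…-19037), Disegni 2020 Thm. 4(1) (`padicBSD_rankOne_nonsplitMult`, PUB), Greenberg–Vatsal Thm. (3.11) (`h311`, PUB),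
Disegni 2020 Thm. 2.4 (`padicGrossZagier_nonsplitMult`, PUB, p660151) — NO preprint: the two theorems are p659820's
`_of_thmE` doors with `hDD` (Dokchitser) + `hKY` (Keller–Yin Thm. E, PRE) REPLACED by the single `hDGZ`, routed through
`upperPartner_at_of_klFlat_partner_of_padicGZ` (Perrin-Riou's argument with Disegni's `p`-adic Gross–Zagier formula for the
twist's analytic rank). What they give (verdict-g12 §2 (iii), the `K`-GIVEN half of the `p ≠ 3` sub-population): at every
odd `p`, for arbitrary line characters, stub 6′'s clause at `(W, p)` from ONE admissible `K` prime to the levels with the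
generalized-Bernoulli UNIT of the twisted character — modulo PUBLISHED facts only; the field SUPPLY with a condition at `p`
stays unprinted for `p ≥ 5` (dead end of record). No `def`, no `sorry`; nothing about any curve is proved unconditionally;
no main conjecture / BSD; 0 cells / labels / stubs / tiers move.

* §1 `upperPartner_at_of_ramifiedOdd_of_bernoulliUnit_of_padicGZ` (FIRST shape: line ramified-odd, `ψ` of any order).
* §2 `upperPartner_at_of_unramifiedEven_of_bernoulliUnit_of_padicGZ` (SECOND shape: line unramified-even, `φ` of any order).

References: [GreenbergVatsal2000] Thm. (1.3), §2 p. 28, §3 Thm. (3.11); [Washington1997] Thm. 4.2, Thm. 5.11;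
[Disegni2020] §2.2 Thm. 2.4, §3.2 Thm. 4; [Wuthrich2014] Thm. 16; [PerrinRiou1987] §1.4.
-/

set_option autoImplicit false

-- `Summit.BirchSwinnertonDyer.BirchSwinnertonDyer.…`: the summit and its single sub-problem share a name.
set_option linter.dupNamespace false

noncomputable section

open scoped Classical MatrixGroups ModularForm NumberTheorySymbols

open CongruenceSubgroup WeierstrassCurve NumberField IsDedekindDomain Field DirichletCharacter Rat.HeightOneSpectrum
  Literature.NumberTheory.EllipticCurves Literature.NumberTheory.GaloisRepresentations
  Literature.NumberTheory.EllipticCurves.ModularForms Literature.NumberTheory.QuadraticFields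
  Literature.NumberTheory.EllipticCurves.Rank1Residual Literature.NumberTheory.EllipticCurves.Rank1Residual.Typed
  Literature.NumberTheory.EllipticCurves.Wuthrich2014 Literature.NumberTheory.EllipticCurves.GreenbergVatsal2000
  Literature.NumberTheory.EllipticCurves.Disegni2020
  Summit.BirchSwinnertonDyer.Rank1Residual Summit.BirchSwinnertonDyer.Rank1Residual.X2
  Summit.BirchSwinnertonDyer.BirchSwinnertonDyer.Theses
  Summit.BirchSwinnertonDyer.BirchSwinnertonDyer.Theorems.EisensteinPrimesLineWeilRelation
  Summit.BirchSwinnertonDyer.BirchSwinnertonDyer.Theorems.EisensteinPrimesMazurMCOnCellBTwistbackKLFlatPartner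
  Summit.BirchSwinnertonDyer.BirchSwinnertonDyer.Theorems.EisensteinPrimesMazurMCOnCellBTwistbackSubrowCarrier
  Summit.BirchSwinnertonDyer.BirchSwinnertonDyer.Theorems.EisensteinPrimesMazurMCOnCellBTwistbackSubrowCarrierEven
  Summit.BirchSwinnertonDyer.BirchSwinnertonDyer.Theorems.EisensteinPrimesMazurMCOnCellBTwistbackPartnerClassNumberLift
  Summit.BirchSwinnertonDyer.BirchSwinnertonDyer.Theorems.EisensteinPrimesLinePsiAtMultiplicativePrime
  Summit.BirchSwinnertonDyer.BirchSwinnertonDyer.Theorems.EisensteinPrimesLinePhiAtMultiplicativePrime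
  Summit.BirchSwinnertonDyer.BirchSwinnertonDyer.Theorems.EisensteinPrimesMazurMCOnCellBTwistbackSubrowCarrierBernoulli
  Summit.BirchSwinnertonDyer.BirchSwinnertonDyer.Theorems.EisensteinPrimesMazurMCOnCellBTwistbackSubrowCarrierBernoulliEven
  Summit.BirchSwinnertonDyer.BirchSwinnertonDyer.Theorems.EisensteinPrimesMazurMCOnCellBTwistbackSubrowPartnerGiven
  Summit.BirchSwinnertonDyer.BirchSwinnertonDyer.Theorems.EisensteinPrimesMazurMCOnCellBTwistbackSubrowPartnerGivenPAdicGZ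

namespace Summit.BirchSwinnertonDyer.BirchSwinnertonDyer.Theorems.EisensteinPrimesMazurMCOnCellBTwistbackSubrowPartnerGivenBernoulliPAdicGZ

section Given

variable (W : WeierstrassCurve ℚ) [W.IsElliptic] [W.IsGloballyMinimal] (p : ℕ) [Fact p.Prime]

/-! ## §1. FIRST shape (line of `E` ramified-odd), `K` given, PUBLISHED facts only -/

/-- **Stub 6′ (∃-PARTNER) AT `(W, p)`, FIRST shape, the analytic rank DERIVED from PUBLISHED facts** — LEAD g12's
`…SubrowPartnerGivenBernoulli.upperPartner_at_of_ramifiedOdd_of_bernoulliUnit_of_thmE` (p659820) with `hDD` + `hKY` REPLACED by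
`hDGZ : padicGrossZagier_nonsplitMult`: the Bernoulli carrier (`exists_klFlatCarrier_twist_of_ramifiedOdd_of_bernoulliUnit`,
`ψ` of ANY order) into this seat's `upperPartner_at_of_klFlat_partner_of_padicGZ` (`(μ_an, λ_an) = (0, 1)` ⟹
`ord_T L_p = 1` ⟹ Perrin-Riou + Disegni Thm. 2.4 ⟹ `r_an = 1`). Inputs BY NAME: `PublishedInputs`, Disegni Thm. 4(1), GV
Thm. (3.11), Disegni Thm. 2.4 — all PUBLISHED. [cite: GreenbergVatsal2000, §3 Thm. (3.11) (p. 43)]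
[cite: Disegni2020, §2.2 Thm. 2.4 and §3.2 Thm. 4] [cite: Wuthrich2014, Thm. 16 (p. 397)] -/
theorem upperPartner_at_of_ramifiedOdd_of_bernoulliUnit_of_padicGZ (hP : EisensteinPrimes.PublishedInputs)
    (hDis : padicBSD_rankOne_nonsplitMult) (h311 : thm311_hasUnitContent_iff_and_order_eq_of_lineRamifiedEven)
    (hDGZ : padicGrossZagier_nonsplitMult)
    (hc : X2.CellB W p) (hns : ¬ W.HasSplitMultiplicativeReductionAtPrime p)
    {Φ₀ : AddSubgroup (geomTorsion W (p : ℤ))} (hΦ : IsRationalLine W p Φ₀)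
    (hram : ¬ LineUnramifiedAt W p Φ₀) (hodd : LineOdd W p Φ₀)
    {m : ℕ} [NeZero m] (φ : DirichletCharacter (ZMod p) m) {d : ℕ} [NeZero d]
    (ψ : DirichletCharacter (ZMod p) d) (hφ : φ.IsPrimitive) (hψ : ψ.IsPrimitive) (hpm : p ∣ m)
    (hpd : ¬ p ∣ d)
    (hφ0 : ∀ (σ : absoluteGaloisGroup ℚ), ∀ P ∈ Φ₀,
      σ • P = (φ ((modNCyclotomicCharacter ℚ m σ : (ZMod m)ˣ) : ZMod m)).val • P)
    (hψ0 : ∀ (σ : absoluteGaloisGroup ℚ) (P : geomTorsion W (p : ℤ)),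
      σ • P - (ψ ((modNCyclotomicCharacter ℚ d σ : (ZMod d)ˣ) : ZMod d)).val • P ∈ Φ₀)
    (S₀ : Finset (HeightOneSpectrum (𝓞 ℚ))) (hS₀p : ∀ v ∈ S₀, ((p : ℕ) : 𝓞 ℚ) ∉ v.asIdeal)
    (hS : ∀ v : HeightOneSpectrum (𝓞 ℚ), v ∉ S₀ → ((p : ℕ) : 𝓞 ℚ) ∉ v.asIdeal → W.HasGoodReductionAt v)
    (hbal : 1 + ∑ v ∈ S₀, delta W p v =
      ∑ v ∈ S₀, ((if φ (Rat.HeightOneSpectrum.natGenerator v : ZMod m) =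
            (Rat.HeightOneSpectrum.natGenerator v : ZMod p)
          then sFactor p (Rat.HeightOneSpectrum.natGenerator v) else 0) +
        (if ψ (Rat.HeightOneSpectrum.natGenerator v : ZMod d) =
            (Rat.HeightOneSpectrum.natGenerator v : ZMod p)
          then sFactor p (Rat.HeightOneSpectrum.natGenerator v) else 0)))
    (K : Type) [Field K] [NumberField K] (hK : IsImaginaryQuadratic K)
    (hHN : SatisfiesHeegnerHypothesis (W.conductorNorm ℤ) K) (hHp : SatisfiesHeegnerHypothesis p K)
    (hoddK : Odd (NumberField.discr K)) (hlt : NumberField.discr K < -4)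
    {N₀ : ℕ} (hHN₀ : SatisfiesHeegnerHypothesis N₀ K)
    (hS₀N₀ : ∀ v ∈ S₀, Rat.HeightOneSpectrum.natGenerator v ∣ N₀)
    (hmK : m.Coprime (NumberField.discr K).natAbs) (hdK : d.Coprime (NumberField.discr K).natAbs)
    (hB : ‖twistedBernoulli p 1 (d * (NumberField.discr K).natAbs) (fun a : ℕ ↦ teichmullerLift p
        (ψ (a : ZMod d) * ((J((a : ℤ) | (NumberField.discr K).natAbs) : ℤ) : ZMod p))⁻¹)‖ = 1) :
    ∃ (K : Type) (_ : Field K) (_ : NumberField K), IsImaginaryQuadratic K ∧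
      SatisfiesHeegnerHypothesis (W.conductorNorm ℤ) K ∧ SatisfiesHeegnerHypothesis p K ∧
      Odd (NumberField.discr K) ∧ NumberField.discr K < -4 ∧
      (W.quadraticTwist (NumberField.discr K : ℚ)).analyticRank = 1 ∧
      ∀ (Wd : WeierstrassCurve ℚ) [Wd.IsElliptic] [Wd.IsGloballyMinimal],
        (∃ C : VariableChange ℚ, C • Wd = W.quadraticTwist (NumberField.discr K : ℚ)) →
        MissingUpperBoundAt Wd p :=
  upperPartner_at_of_klFlat_partner_of_padicGZ hP hDis h311 hDGZ W p hc hns K hK hHN hHp hoddK hlt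
    (exists_klFlatCarrier_twist_of_ramifiedOdd_of_bernoulliUnit W p hc.2.1 hns hΦ hram hodd φ ψ hφ hψ hpm hpd hφ0 hψ0
      S₀ hS₀p hS hbal K hK hHp (discr_emod_four_eq_one_of_odd hK.1 hoddK) hlt hHN₀ hS₀N₀ hmK hdK hB)

/-! ## §2. SECOND shape (line of `E` unramified-even), `K` given, PUBLISHED facts only -/

/-- **Stub 6′ (∃-PARTNER) AT `(W, p)`, SECOND shape, the analytic rank DERIVED from PUBLISHED facts** — p659820's
`upperPartner_at_of_unramifiedEven_of_bernoulliUnit_of_thmE` with `hDD` + `hKY` REPLACED by `hDGZ` (the Bernoulli carrier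
`exists_klFlatCarrier_twist_of_unramifiedEven_of_bernoulliUnit`, `φ` of ANY order, into `upperPartner_at_of_klFlat_partner_of_padicGZ`).
[cite: GreenbergVatsal2000, §3 Thm. (3.11) and §2 p. 28] [cite: Disegni2020, §2.2 Thm. 2.4 and §3.2 Thm. 4]
[cite: Wuthrich2014, Thm. 16 (p. 397)] -/
theorem upperPartner_at_of_unramifiedEven_of_bernoulliUnit_of_padicGZ (hP : EisensteinPrimes.PublishedInputs)
    (hDis : padicBSD_rankOne_nonsplitMult) (h311 : thm311_hasUnitContent_iff_and_order_eq_of_lineRamifiedEven)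
    (hDGZ : padicGrossZagier_nonsplitMult)
    (hc : X2.CellB W p) (hns : ¬ W.HasSplitMultiplicativeReductionAtPrime p)
    {Φ₀ : AddSubgroup (geomTorsion W (p : ℤ))} (hΦ : IsRationalLine W p Φ₀)
    (hunr : LineUnramifiedAt W p Φ₀) (heven : LineEven W p Φ₀)
    {m : ℕ} [NeZero m] (φ : DirichletCharacter (ZMod p) m) {d : ℕ} [NeZero d]
    (ψ : DirichletCharacter (ZMod p) d) (hφ : φ.IsPrimitive) (hψ : ψ.IsPrimitive) (hpm : ¬ p ∣ m)
    (hpd : p ∣ d)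
    (hφ0 : ∀ (σ : absoluteGaloisGroup ℚ), ∀ P ∈ Φ₀,
      σ • P = (φ ((modNCyclotomicCharacter ℚ m σ : (ZMod m)ˣ) : ZMod m)).val • P)
    (hψ0 : ∀ (σ : absoluteGaloisGroup ℚ) (P : geomTorsion W (p : ℤ)),
      σ • P - (ψ ((modNCyclotomicCharacter ℚ d σ : (ZMod d)ˣ) : ZMod d)).val • P ∈ Φ₀)
    (S₀ : Finset (HeightOneSpectrum (𝓞 ℚ))) (hS₀p : ∀ v ∈ S₀, ((p : ℕ) : 𝓞 ℚ) ∉ v.asIdeal)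
    (hS : ∀ v : HeightOneSpectrum (𝓞 ℚ), v ∉ S₀ → ((p : ℕ) : 𝓞 ℚ) ∉ v.asIdeal → W.HasGoodReductionAt v)
    (hbal : 1 + ∑ v ∈ S₀, delta W p v =
      ∑ v ∈ S₀, ((if φ (Rat.HeightOneSpectrum.natGenerator v : ZMod m) =
            (Rat.HeightOneSpectrum.natGenerator v : ZMod p)
          then sFactor p (Rat.HeightOneSpectrum.natGenerator v) else 0) +
        (if ψ (Rat.HeightOneSpectrum.natGenerator v : ZMod d) =
            (Rat.HeightOneSpectrum.natGenerator v : ZMod p)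
          then sFactor p (Rat.HeightOneSpectrum.natGenerator v) else 0)))
    (K : Type) [Field K] [NumberField K] (hK : IsImaginaryQuadratic K)
    (hHN : SatisfiesHeegnerHypothesis (W.conductorNorm ℤ) K) (hHp : SatisfiesHeegnerHypothesis p K)
    (hoddK : Odd (NumberField.discr K)) (hlt : NumberField.discr K < -4)
    {N₀ : ℕ} (hHN₀ : SatisfiesHeegnerHypothesis N₀ K)
    (hS₀N₀ : ∀ v ∈ S₀, Rat.HeightOneSpectrum.natGenerator v ∣ N₀)
    (hmK : m.Coprime (NumberField.discr K).natAbs) (hdK : d.Coprime (NumberField.discr K).natAbs)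
    (hB : ‖twistedBernoulli p 1 (m * (NumberField.discr K).natAbs) (fun a : ℕ ↦ teichmullerLift p
        (φ (a : ZMod m) * ((J((a : ℤ) | (NumberField.discr K).natAbs) : ℤ) : ZMod p))⁻¹)‖ = 1) :
    ∃ (K : Type) (_ : Field K) (_ : NumberField K), IsImaginaryQuadratic K ∧
      SatisfiesHeegnerHypothesis (W.conductorNorm ℤ) K ∧ SatisfiesHeegnerHypothesis p K ∧
      Odd (NumberField.discr K) ∧ NumberField.discr K < -4 ∧
      (W.quadraticTwist (NumberField.discr K : ℚ)).analyticRank = 1 ∧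
      ∀ (Wd : WeierstrassCurve ℚ) [Wd.IsElliptic] [Wd.IsGloballyMinimal],
        (∃ C : VariableChange ℚ, C • Wd = W.quadraticTwist (NumberField.discr K : ℚ)) →
        MissingUpperBoundAt Wd p :=
  upperPartner_at_of_klFlat_partner_of_padicGZ hP hDis h311 hDGZ W p hc hns K hK hHN hHp hoddK hlt
    (exists_klFlatCarrier_twist_of_unramifiedEven_of_bernoulliUnit W p hc.2.1 hns hΦ hunr heven φ ψ hφ hψ hpm hpd hφ0
      hψ0 S₀ hS₀p hS hbal K hK hHp (discr_emod_four_eq_one_of_odd hK.1 hoddK) hlt hHN₀ hS₀N₀ hmK hdK hB)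

end Given

end Summit.BirchSwinnertonDyer.BirchSwinnertonDyer.Theorems.EisensteinPrimesMazurMCOnCellBTwistbackSubrowPartnerGivenBernoulliPAdicGZ

end
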